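import Summits.HubbardSuperconductivity.HubbardLadder.Bounds.ThermalKuboCurvature
import HarnessLib
import HarnessLib.Audit

/-!
# Hubbard ladder — Bounds: the Kubo-curvature stiffness ceiling along a MULTI-FREQUENCY flux
# curve (finite-dimensional engine for general one-forms)

HONEST FRAMING (cell pub-hubbard): ladder R1–R4 with certified numbers; no claim on H/H₀. This is
a bound for a MODEL CLASS (finite-dimensional Gibbs states of Hermitian matrices), instantiated in
the companion file `ThermalKuboCurvatureNumberConserving.lean` for the general number-conserving
class `T(t e^{iθd}) + V` on any finite hopping graph; no materials claim. Companion text: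
`pub-hubbard/paper/bounds.tex` Thm 6_T; table `pub-hubbard/pub-hubbard-bounds/BOUNDS.md` row T1j.

## What is proved here (no `sorry`, no new axioms)

`KuboCurvatureStiffnessCeilingMulti` (`@[conjecture] def`, PROVED by
`kuboCurvatureStiffnessCeilingMulti_holds` from `stiffness_le_multi_kin_sub_duhamel`): for
Hermitian `H, J` on a nonempty finite index type, a finite family of matrices `K_i, P_i` with
real frequencies `v_i` whose remainder
`R(θ) = Σ_i (cos(θ v_i) − 1) K_i + Σ_i (sin(θ v_i) − θ v_i) P_i` is Hermitian for every `θ`,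
`β > 0`, `θ₀ > 0`: if the free energy is stiff along the curve `H(θ) = H + θ J + R(θ)`,
`β ρ θ² ≤ log Z_β(H) − log Z_β(H(θ))` for `|θ| ≤ θ₀`, then `Re⟨J⟩_β = 0` and

  `ρ ≤ −½ Σ_i v_i² Re⟨K_i⟩_β − (β/2) Re (J, J)_β`,   `(J, J)_β = duhamel β H J J ≥ 0`.

The two-term engine `stiffness_le_half_kin_sub_duhamel` (`ThermalKuboCurvature.lean`) is the case
of a single frequency (`H + (1 − cos θc) K + sin(θc) J`); a Peierls curve `t_{xy} e^{iθ d_{xy}}`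
with a general one-form `d` has one frequency per bond, which is what this file handles. The
individual `K_i, P_i` need not be Hermitian (in the application they are single hopping terms
`t_{xy} c†_{xσ} c_{yσ}`); only the total remainder is.

Proof (all in Lean). Peierls–Bogoliubov (`log_partitionFn_sub_le_log_partitionFn_add`) at the
base point `H + θJ` peels off `R(θ)`, leaving
`g(θ) = log Tr e^{A + θY} − β Re⟨R(θ)⟩_{H + θJ} + β ρ θ² − log Tr e^{A}` (`A = −βH`, `Y = −βJ`)
with `g ≤ 0 = g(0)` on `[−θ₀, θ₀]`; `Re⟨R(θ)⟩_{H+θJ} = Σ_i u_i(θ) w_i(θ)` with coefficients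
`u_i(0) = u_i'(0) = 0` and `w_i` differentiable (tree's Duhamel calculus along the LINE
`θ ↦ A + θY`: `hasDerivAt_re_trace_exp_add_smul`, `hasDerivAt_trace_mul_exp_add_smul`), so `g'`
exists everywhere and is differentiable at `0` (`hasDerivAt_mul_of_hasDerivAt_zero`); a local
maximum gives `g'(0) = 0` (whence `⟨J⟩ = 0`) and `g''(0) ≤ 0` (`deriv2_nonpos_of_eventually_le`),
and `g''(0) = β² Z⁻¹ Re ∫₀¹ Tr(J e^{−sβH} J e^{−(1−s)βH}) ds + β Σ_i v_i² Re⟨K_i⟩ + 2βρ`.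

References (keys of `lean/references.bib`): ScalapinoWhiteZhang1993 §II (Kubo formula for `D_s`);
DLS1978 §3 (Duhamel two-point function); ParamekantiTrivediRanderia1998 §II–IV;
HazraVermaRanderia2019 eq. (2).
-/

noncomputable section

namespace Summit.HubbardSuperconductivity.HubbardLadder.Bounds

open Matrix Finset MeasureTheory intervalIntegral Filter Topology NormedSpace Asymptotics
open Literature.MathematicalPhysics.QuantumLattice
open scoped ComplexOrder ComplexConjugate Matrix.Norms.L2Operator

variable {m : Type*} [Fintype m] [DecidableEq m]

/-- **Stiffness coefficient ≤ half the Kubo curvature, multi-frequency curve.** For Hermitian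
`H, J` (nonempty finite index type), matrices `K_i, P_i` and reals `v_i` (`i` in a finite type)
with `R(θ) = Σ_i (cos(θv_i) − 1) K_i + Σ_i (sin(θv_i) − θv_i) P_i` Hermitian, `β > 0`, `θ₀ > 0`:
if `β ρ θ² ≤ log Z_β(H) − log Z_β(H + θJ + R(θ))` for `|θ| ≤ θ₀`, then
`ρ ≤ −½ Σ_i v_i² Re⟨K_i⟩_β − (β/2) Re (J,J)_β` and `Re⟨J⟩_β = 0`.
[cite: ScalapinoWhiteZhang1993, §II] -/
theorem stiffness_le_multi_kin_sub_duhamel [Nonempty m] {ι : Type*} [Fintype ι]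
    {H J : Matrix m m ℂ} (hH : H.IsHermitian) (hJ : J.IsHermitian) (K P : ι → Matrix m m ℂ)
    (v : ι → ℝ)
    (hR : ∀ θ : ℝ, (∑ i, ((Real.cos (θ * v i) - 1 : ℝ) : ℂ) • K i +
      ∑ i, ((Real.sin (θ * v i) - θ * v i : ℝ) : ℂ) • P i).IsHermitian)
    {β ρ θ₀ : ℝ} (hβ : 0 < β) (hθ₀ : 0 < θ₀)
    (hyp : ∀ θ : ℝ, |θ| ≤ θ₀ → β * ρ * θ ^ 2 ≤ Real.log (partitionFn β H).re -
        Real.log (partitionFn β (H + ((θ : ℝ) : ℂ) • J +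
          (∑ i, ((Real.cos (θ * v i) - 1 : ℝ) : ℂ) • K i +
            ∑ i, ((Real.sin (θ * v i) - θ * v i : ℝ) : ℂ) • P i))).re) :
    ρ ≤ -(∑ i, v i ^ 2 * (gibbsState β H (K i)).re) / 2 - β / 2 * (duhamel β H J J).re ∧
      (gibbsState β H J).re = 0 := by
  -- abbreviations: `A = -βH`, `Y = -βJ`, the line `s ↦ H + sJ`
  set A : Matrix m m ℂ := -(β : ℂ) • H with hA
  set Y : Matrix m m ℂ := -(β : ℂ) • J with hY
  have hsm : ∀ {V : Matrix m m ℂ}, V.IsHermitian → ∀ r : ℝ, ((r : ℂ) • V).IsHermitian :=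
    fun hV r => by rw [IsHermitian, conjTranspose_smul, hV.eq]; simp
  have hHs : ∀ s : ℝ, (H + ((s : ℝ) : ℂ) • J).IsHermitian := fun s => hH.add (hsm hJ s)
  have hgw : ∀ s : ℝ, gibbsWeight β (H + ((s : ℝ) : ℂ) • J) = exp (A + s • Y) := by
    intro s
    rw [gibbsWeight, hA, hY, ← Complex.coe_smul]
    congr 1
    module
  set Z : ℝ → ℝ := fun s => (exp (A + s • Y)).trace.re with hZ
  set Z₁ : ℝ → ℝ := fun s => (Y * exp (A + s • Y)).trace.re with hZ₁
  set N : ι → ℝ → ℝ := fun i s => (K i * exp (A + s • Y)).trace.re with hN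
  set N₁ : ι → ℝ → ℝ := fun i s => (∫ u in (0:ℝ)..1,
    (K i * (exp (u • (A + s • Y)) * Y * exp ((1 - u) • (A + s • Y)))).trace).re with hN₁
  set M : ι → ℝ → ℝ := fun i s => (P i * exp (A + s • Y)).trace.re with hM
  set M₁ : ι → ℝ → ℝ := fun i s => (∫ u in (0:ℝ)..1,
    (P i * (exp (u • (A + s • Y)) * Y * exp ((1 - u) • (A + s • Y)))).trace).re with hM₁
  set I₂ : ℂ := ∫ u in (0:ℝ)..1,
    (J * gibbsWeight (u * β) H * J * gibbsWeight ((1 - u) * β) H).trace with hI₂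
  -- `Z = Σ e^{-βEᵢ} > 0`, and the thermal quantities on the line
  have hZsum : ∀ s, Z s = ∑ i, Real.exp (-(β * (hHs s).eigenvalues i)) := by
    intro s
    simp only [hZ]
    rw [← hgw, ← partitionFn, (hHs s).partitionFn_eq_ofReal, Complex.ofReal_re]
  have hZpos : ∀ s, 0 < Z s := fun s => by rw [hZsum]; exact (hHs s).sum_exp_pos β
  have hZre : ∀ s, (partitionFn β (H + ((s : ℝ) : ℂ) • J)).re = Z s := by
    intro s; simp only [hZ]; rw [partitionFn, hgw]
  have hEK : ∀ i s, (gibbsState β (H + ((s : ℝ) : ℂ) • J) (K i)).re = N i s / Z s := by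
    intro i s
    rw [(hHs s).re_gibbsState, ← hZsum, trace_mul_comm, hgw, inv_mul_eq_div]
  have hEP : ∀ i s, (gibbsState β (H + ((s : ℝ) : ℂ) • J) (P i)).re = M i s / Z s := by
    intro i s
    rw [(hHs s).re_gibbsState, ← hZsum, trace_mul_comm, hgw, inv_mul_eq_div]
  have hZ0 : (partitionFn β H).re = Z 0 := by
    have h := hZre 0; simpa using h
  have hEK0 : ∀ i, (gibbsState β H (K i)).re = N i 0 / Z 0 := by
    intro i; have h := hEK i 0; simpa using h
  have hSum : ∑ i, Real.exp (-(β * hH.eigenvalues i)) = Z 0 := by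
    rw [← hZ0, hH.partitionFn_eq_ofReal, Complex.ofReal_re]
  have hduh : (duhamel β H J J).re = I₂.re / Z 0 := by
    rw [hH.re_duhamel, hSum, inv_mul_eq_div]
  -- the remainder's expectation on the line
  have hER : ∀ θ : ℝ, (gibbsState β (H + ((θ : ℝ) : ℂ) • J)
      (∑ i, ((Real.cos (θ * v i) - 1 : ℝ) : ℂ) • K i +
        ∑ i, ((Real.sin (θ * v i) - θ * v i : ℝ) : ℂ) • P i)).re =
      ∑ i, (Real.cos (θ * v i) - 1) * (N i θ / Z θ) +
        ∑ i, (Real.sin (θ * v i) - θ * v i) * (M i θ / Z θ) := by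
    intro θ
    simp only [map_add, map_sum, map_smul, smul_eq_mul, Complex.add_re, Complex.re_sum,
      Complex.re_ofReal_mul, hEK, hEP]
  -- the function `g ≤ 0` near `0`, `g 0 = 0`
  set E' : ι → ℝ → ℝ := fun i θ => (N₁ i θ * Z θ - N i θ * Z₁ θ) / Z θ ^ 2 with hE'
  set F' : ι → ℝ → ℝ := fun i θ => (M₁ i θ * Z θ - M i θ * Z₁ θ) / Z θ ^ 2 with hF'
  set g : ℝ → ℝ := fun θ => Real.log (Z θ) -
      β * (∑ i, (Real.cos (θ * v i) - 1) * (N i θ / Z θ) +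
        ∑ i, (Real.sin (θ * v i) - θ * v i) * (M i θ / Z θ)) +
      β * ρ * θ ^ 2 - Real.log (Z 0) with hg
  have hg0 : g 0 = 0 := by simp [hg]
  have hgle : ∀ θ, |θ| ≤ θ₀ → g θ ≤ 0 := by
    intro θ hθ
    have h1 := hyp θ hθ
    have hPB := log_partitionFn_sub_le_log_partitionFn_add (hHs θ) (hR θ) β
    rw [hER θ, hZre] at hPB
    rw [hZ0] at h1
    have hgθ : g θ = Real.log (Z θ) -
        β * (∑ i, (Real.cos (θ * v i) - 1) * (N i θ / Z θ) +
          ∑ i, (Real.sin (θ * v i) - θ * v i) * (M i θ / Z θ)) +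
        β * ρ * θ ^ 2 - Real.log (Z 0) := rfl
    rw [hgθ]
    linarith
  -- first derivatives everywhere, continuity
  have hZd : ∀ s, HasDerivAt Z (Z₁ s) s := fun s => hasDerivAt_re_trace_exp_add_smul A Y s
  have hNd : ∀ i s, HasDerivAt (N i) (N₁ i s) s := fun i s =>
    hasDerivAt_re_trace_const_mul_exp_add_smul (K i) A Y s
  have hMd : ∀ i s, HasDerivAt (M i) (M₁ i s) s := fun i s =>
    hasDerivAt_re_trace_const_mul_exp_add_smul (P i) A Y s
  have hZ₁d : HasDerivAt Z₁ (β ^ 2 * I₂.re) 0 := by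
    have h := hasDerivAt_re_trace_mul_exp_add_smul A Y 0
    simp only [zero_smul, add_zero] at h
    refine h.congr_deriv ?_
    have key : ∀ u : ℝ, (Y * (exp (u • A) * Y * exp ((1 - u) • A))).trace =
        (β : ℂ) ^ 2 * (J * gibbsWeight (u * β) H * J * gibbsWeight ((1 - u) * β) H).trace := by
      intro u
      rw [hA, hY, exp_smul_neg_smul_eq_gibbsWeight, exp_smul_neg_smul_eq_gibbsWeight]
      simp only [Matrix.smul_mul, Matrix.mul_smul, trace_smul, smul_eq_mul, Matrix.mul_assoc]
      ring
    simp_rw [key]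
    rw [intervalIntegral.integral_const_mul, ← hI₂,
      show (β : ℂ) ^ 2 = ((β ^ 2 : ℝ) : ℂ) by push_cast; ring, Complex.re_ofReal_mul]
  have hZc : Continuous Z := continuous_re_trace_exp_add_smul A Y
  have hZ₁c : Continuous Z₁ := continuous_iff_continuousAt.2 fun s =>
    (hasDerivAt_re_trace_mul_exp_add_smul A Y s).continuousAt
  have hNc : ∀ i, Continuous (N i) := fun i => continuous_re_trace_const_mul_exp_add_smul (K i) A Y
  have hN₁c : ∀ i, Continuous (N₁ i) := fun i => continuous_re_integral_trace_mul (K i) A Y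
  have hMc : ∀ i, Continuous (M i) := fun i => continuous_re_trace_const_mul_exp_add_smul (P i) A Y
  have hM₁c : ∀ i, Continuous (M₁ i) := fun i => continuous_re_integral_trace_mul (P i) A Y
  have hEd : ∀ i θ, HasDerivAt (fun θ => N i θ / Z θ) (E' i θ) θ := fun i θ =>
    (hNd i θ).div (hZd θ) (hZpos θ).ne'
  have hFd : ∀ i θ, HasDerivAt (fun θ => M i θ / Z θ) (F' i θ) θ := fun i θ =>
    (hMd i θ).div (hZd θ) (hZpos θ).ne'
  have hE'c : ∀ i, Continuous (E' i) := fun i => by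
    simp only [hE']
    exact (((hN₁c i).mul hZc).sub ((hNc i).mul hZ₁c)).div (hZc.pow 2)
      fun θ => pow_ne_zero 2 (hZpos θ).ne'
  have hF'c : ∀ i, Continuous (F' i) := fun i => by
    simp only [hF']
    exact (((hM₁c i).mul hZc).sub ((hMc i).mul hZ₁c)).div (hZc.pow 2)
      fun θ => pow_ne_zero 2 (hZpos θ).ne'
  have hcosd : ∀ i θ, HasDerivAt (fun θ : ℝ => Real.cos (θ * v i) - 1)
      (-(Real.sin (θ * v i) * v i)) θ := fun i θ => by
    have h := (((hasDerivAt_id θ).mul_const (v i)).cos).sub_const 1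
    simpa using h
  have hsind : ∀ i θ, HasDerivAt (fun θ : ℝ => Real.sin (θ * v i) - θ * v i)
      (Real.cos (θ * v i) * v i - v i) θ := fun i θ => by
    have h :=
      (((hasDerivAt_id θ).mul_const (v i)).sin).fun_sub ((hasDerivAt_id θ).mul_const (v i))
    simpa using h
  set g' : ℝ → ℝ := fun θ => Z₁ θ / Z θ -
      β * (∑ i, (-(Real.sin (θ * v i) * v i) * (N i θ / Z θ) +
          (Real.cos (θ * v i) - 1) * E' i θ) +
        ∑ i, ((Real.cos (θ * v i) * v i - v i) * (M i θ / Z θ) +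
          (Real.sin (θ * v i) - θ * v i) * F' i θ)) + β * ρ * (2 * θ) with hg'
  have hS1 : ∀ θ, HasDerivAt (fun θ => ∑ i, (Real.cos (θ * v i) - 1) * (N i θ / Z θ))
      (∑ i, (-(Real.sin (θ * v i) * v i) * (N i θ / Z θ) +
        (Real.cos (θ * v i) - 1) * E' i θ)) θ := fun θ =>
    HasDerivAt.fun_sum fun i _ => (hcosd i θ).mul (hEd i θ)
  have hS2 : ∀ θ, HasDerivAt (fun θ => ∑ i, (Real.sin (θ * v i) - θ * v i) * (M i θ / Z θ))
      (∑ i, ((Real.cos (θ * v i) * v i - v i) * (M i θ / Z θ) +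
        (Real.sin (θ * v i) - θ * v i) * F' i θ)) θ := fun θ =>
    HasDerivAt.fun_sum fun i _ => (hsind i θ).mul (hFd i θ)
  have hgd : ∀ θ, HasDerivAt g (g' θ) θ := fun θ => by
    have h1 : HasDerivAt (fun θ => Real.log (Z θ)) (Z₁ θ / Z θ) θ :=
      (hZd θ).log (hZpos θ).ne'
    have h3 : HasDerivAt (fun θ : ℝ => β * ρ * θ ^ 2) (β * ρ * (2 * θ)) θ := by
      have h := (hasDerivAt_pow 2 θ).const_mul (β * ρ)
      simpa using h
    exact ((h1.sub (((hS1 θ).add (hS2 θ)).const_mul β)).add h3).sub_const (Real.log (Z 0))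
  -- local maximum at `0`: first derivative vanishes, i.e. `⟨J⟩ = 0`
  have hev : ∀ᶠ θ in 𝓝 (0:ℝ), g θ ≤ g 0 := by
    rw [hg0]
    have hI : Set.Icc (-θ₀) θ₀ ∈ 𝓝 (0 : ℝ) := Icc_mem_nhds (by linarith) hθ₀
    exact Filter.mem_of_superset hI fun θ hθ => hgle θ (abs_le.2 ⟨hθ.1, hθ.2⟩)
  have hmax : IsLocalMax g 0 := hev
  have hZ₁0 : Z₁ 0 = 0 := by
    have h := hmax.hasDerivAt_eq_zero (hgd 0)
    have h' : g' 0 = Z₁ 0 / Z 0 := by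
      simp [hg']
    rw [h'] at h
    rcases div_eq_zero_iff.1 h with h | h
    · exact h
    · exact absurd h (hZpos 0).ne'
  have hJgw : (J * gibbsWeight β H).trace.re = 0 := by
    have h : Z₁ 0 = -(β * (J * gibbsWeight β H).trace.re) := by
      have e : exp A = gibbsWeight β H := by rw [hA]; rfl
      simp only [hZ₁, zero_smul, add_zero]
      rw [e, hY, Matrix.smul_mul, trace_smul, smul_eq_mul, neg_mul, Complex.neg_re,
        Complex.re_ofReal_mul]
    rw [hZ₁0] at h
    have h2 : β * (J * gibbsWeight β H).trace.re = 0 := by linarith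
    exact (mul_eq_zero.1 h2).resolve_left hβ.ne'
  -- second derivative at `0`
  have hquot : HasDerivAt (fun θ => Z₁ θ / Z θ)
      ((β ^ 2 * I₂.re * Z 0 - Z₁ 0 * Z₁ 0) / Z 0 ^ 2) 0 := hZ₁d.div (hZd 0) (hZpos 0).ne'
  have hT1 : ∀ i, HasDerivAt (fun θ : ℝ => -(Real.sin (θ * v i) * v i) * (N i θ / Z θ))
      (-(v i * v i) * (N i 0 / Z 0) + -(Real.sin (0 * v i) * v i) * E' i 0) 0 := fun i => by
    have hds : HasDerivAt (fun θ : ℝ => -(Real.sin (θ * v i) * v i)) (-(v i * v i)) 0 := by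
      have h := ((((hasDerivAt_id (0:ℝ)).mul_const (v i)).sin).mul_const (v i)).fun_neg
      simpa using h
    exact hds.mul (hEd i 0)
  have hT2 : ∀ i, HasDerivAt (fun θ : ℝ => (Real.cos (θ * v i) - 1) * E' i θ) 0 0 := fun i =>
    hasDerivAt_mul_of_hasDerivAt_zero (by have h := hcosd i 0; simpa using h) (by simp)
      (hE'c i).continuousAt
  have hT3 : ∀ i, HasDerivAt (fun θ : ℝ => (Real.cos (θ * v i) * v i - v i) * (M i θ / Z θ))
      0 0 := fun i => by
    have hdc : HasDerivAt (fun θ : ℝ => Real.cos (θ * v i) * v i - v i) 0 0 := by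
      have h := ((((hasDerivAt_id (0:ℝ)).mul_const (v i)).cos).mul_const (v i)).sub_const (v i)
      simpa using h
    exact hasDerivAt_mul_of_hasDerivAt_zero hdc (by simp) (hFd i 0).continuousAt
  have hT4 : ∀ i, HasDerivAt (fun θ : ℝ => (Real.sin (θ * v i) - θ * v i) * F' i θ) 0 0 :=
    fun i => hasDerivAt_mul_of_hasDerivAt_zero (by have h := hsind i 0; simpa using h) (by simp)
      (hF'c i).continuousAt
  have hS1' : HasDerivAt (fun θ => ∑ i, (-(Real.sin (θ * v i) * v i) * (N i θ / Z θ) +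
      (Real.cos (θ * v i) - 1) * E' i θ))
      (∑ i, (-(v i * v i) * (N i 0 / Z 0) + -(Real.sin (0 * v i) * v i) * E' i 0 + 0)) 0 :=
    HasDerivAt.fun_sum fun i _ => (hT1 i).add (hT2 i)
  have hS2' : HasDerivAt (fun θ => ∑ i, ((Real.cos (θ * v i) * v i - v i) * (M i θ / Z θ) +
      (Real.sin (θ * v i) - θ * v i) * F' i θ)) (∑ _i : ι, ((0 : ℝ) + 0)) 0 :=
    HasDerivAt.fun_sum fun i _ => (hT3 i).add (hT4 i)
  have hQ : HasDerivAt (fun θ : ℝ => β * ρ * (2 * θ)) (β * ρ * 2) 0 := by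
    have h := ((hasDerivAt_id (0:ℝ)).const_mul 2).const_mul (β * ρ)
    simpa using h
  have hg'd : HasDerivAt g'
      (β ^ 2 * (I₂.re / Z 0) + β * (∑ i, v i ^ 2 * (N i 0 / Z 0)) + 2 * β * ρ) 0 := by
    have h := (hquot.sub ((hS1'.add hS2').const_mul β)).add hQ
    refine h.congr_deriv ?_
    simp only [hZ₁0, Real.sin_zero, zero_mul, neg_zero, add_zero, Finset.sum_const_zero,
      neg_mul, Finset.sum_neg_distrib, mul_neg, sub_neg_eq_add, ← sq]
    have hZ0ne := (hZpos 0).ne'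
    field_simp
    ring
  have hd := deriv2_nonpos_of_eventually_le hev hgd hg'd
  -- conclusion
  refine ⟨?_, ?_⟩
  · rw [hduh]
    simp_rw [hEK0]
    have key : β * (I₂.re / Z 0) + (∑ i, v i ^ 2 * (N i 0 / Z 0)) + 2 * ρ ≤ 0 := by
      by_contra hcon
      push Not at hcon
      have h2 := mul_pos hβ hcon
      nlinarith [hd, h2]
    nlinarith [key]
  · rw [hH.re_gibbsState, trace_mul_comm, hJgw, mul_zero]


/-! ### Node -/

/-- **Kubo-curvature stiffness ceiling along a multi-frequency flux curve (finite-dimensional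
engine)** — conjecture node, PROVED below (`kuboCurvatureStiffnessCeilingMulti_holds`): for
Hermitian `H, J` on a nonempty finite index type, matrices `K_i, P_i` and frequencies `v_i`
(finite index type) with `R(θ) = Σ_i (cos(θv_i) − 1) K_i + Σ_i (sin(θv_i) − θv_i) P_i` Hermitian,
`0 < β`, `0 < θ₀`: stiffness `β ρ θ² ≤ log Z_β(H) − log Z_β(H + θJ + R(θ))` on `|θ| ≤ θ₀` forces
`Re⟨J⟩_β = 0` and `ρ ≤ −½ Σ_i v_i² Re⟨K_i⟩_β − β/2 · Re duhamel β H J J`.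
[cite: ScalapinoWhiteZhang1993, §II] -/
@[conjecture] def KuboCurvatureStiffnessCeilingMulti : Prop :=
  ∀ (m : Type) [Fintype m] [DecidableEq m] [Nonempty m] (ι : Type) [Fintype ι]
    (H J : Matrix m m ℂ) (K P : ι → Matrix m m ℂ) (v : ι → ℝ),
    H.IsHermitian → J.IsHermitian →
    (∀ θ : ℝ, (∑ i, ((Real.cos (θ * v i) - 1 : ℝ) : ℂ) • K i +
      ∑ i, ((Real.sin (θ * v i) - θ * v i : ℝ) : ℂ) • P i).IsHermitian) →
    ∀ (β ρ θ₀ : ℝ), 0 < β → 0 < θ₀ →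
    (∀ θ : ℝ, |θ| ≤ θ₀ → β * ρ * θ ^ 2 ≤ Real.log (partitionFn β H).re -
        Real.log (partitionFn β (H + ((θ : ℝ) : ℂ) • J +
          (∑ i, ((Real.cos (θ * v i) - 1 : ℝ) : ℂ) • K i +
            ∑ i, ((Real.sin (θ * v i) - θ * v i : ℝ) : ℂ) • P i))).re) →
    ρ ≤ -(∑ i, v i ^ 2 * (gibbsState β H (K i)).re) / 2 - β / 2 * (duhamel β H J J).re ∧
      (gibbsState β H J).re = 0

/-- Proof of the node `KuboCurvatureStiffnessCeilingMulti`. -/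
theorem kuboCurvatureStiffnessCeilingMulti_holds : KuboCurvatureStiffnessCeilingMulti := by
  intro m _ _ _ ι _ H J K P v hH hJ hR β ρ θ₀ hβ hθ₀ hyp
  exact stiffness_le_multi_kin_sub_duhamel hH hJ K P v hR hβ hθ₀ hyp

end Summit.HubbardSuperconductivity.HubbardLadder.Bounds
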